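import Literature.Computability.QuantumComplexity.CountingSimulationRel
import Literature.Computability.QuantumComplexity.CoinFamilyKernel
import Literature.Computability.Complexity.OracleComposition
import HarnessLib

/-!
# `BPP^A ⊆ BQP^A` from the relativized reversible simulation (Bernstein–Vazirani 1997, Thm. 8.3 relativized)

Proof file (theorems only) for the named fact `BPPRel_ofLanguage_subset_BQPRel` of
`CountingSimulationRel.lean` — "`BPP^A ⊆ BQP^A` for every oracle language `A`"
(E. Bernstein, U. Vazirani, *Quantum complexity theory*, SIAM J. Comput. 26 (1997), Thm. 8.3
`BPP ⊆ BQP` carried out with oracle queries as in their §8.3 [BernsteinVazirani1997SICOMP]; the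
leaf shared by Fortnow–Rogers' Cor. 3.7 and Thm. 4.2 in
`Literature/Barriers/QuantumAdvantage/SupremacyTheoremsNonRelativizingProofs.lean`).

**Main result.** `BPPRel_ofLanguage_subset_BQPRel_of_sim : uniformOracleCoinSimulation → BPPRel_ofLanguage_subset_BQPRel`:
the fact is reduced, by a proof, to the tree's named fact `uniformOracleCoinSimulation`
(`CoinFamilyKernel.lean`: the polynomial-time uniform reversible simulation, with oracle gates,
of an `FP^A` function of `⟨x, coins⟩`, its output a prefix of the read-out; its coin-free
one-bit case `uniformReversibleSimulation` is proved in `SimUniformity.lean`). Proof: for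
`L ∈ BPP^A = bp (P^A)` with witness `L' ∈ P^A` and coin polynomial `p`, the one-symbol answer
function `w ↦ [w ∈ L']` is in `FP^A` (`OracleAlg.ofLanguage_mem_FPRel_of_mem_PRel`); the uniform
coin family of `exists_uniform_kernelProb_ge_uniformProb` outputs a string starting with `true`
with probability at least `Pr_y[⟨x, y⟩ ∈ L']` and one starting with `false` with probability at
least `Pr_y[⟨x, y⟩ ∉ L']`; the first is the acceptance probability
(`kernelProb_prefix_true_eq_acceptProbOn`), the two are at most `1` together
(`kernelProb_add_kernelProb_le_one`), so the `2/3` of `bp` gives acceptance `≥ 2/3` on `x ∈ L` and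
`≤ 1/3` on `x ∉ L`.

Corollaries: `PRel_ofLanguage_subset_BQPRel_of_sim` (`P^A ⊆ BQP^A`, with the discharged
`P^O ⊆ BPP^O`).

## Sources

* [BernsteinVazirani1997SICOMP] Thm. 8.3 (p. 1451) and §8.3 (oracle QTMs), as cited by
  `CountingSimulationRel.lean` and `CoinFamilyKernel.lean`.
* [FortnowRogers1999JCSS] proof of Thm. 4.2, p. 7 ("and so `P = BPP = BQP`"), consumer of the fact.
-/

noncomputable section

namespace Literature.Computability.QuantumComplexity

open _root_.Computability Complexity Cryptography

/-! ### Reading the first output wire off the kernel -/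

/-- **The first output wire**: the probability that the measured output string of the family
starts with `true` is the acceptance probability `acceptProbOn` (both are the junk value `0` on
the empty register). [cite: NielsenChuang2010, §2.2.5 (Born rule)] -/
theorem kernelProb_prefix_true_eq_acceptProbOn (F : QCircuitFamily cliffordT) (A : Language Bool)
    (x : List Bool) : F.kernelProb A x {y | [true] <+: y} = F.acceptProbOn A x := by
  classical
  unfold QCircuitFamily.kernelProb QCircuitFamily.kernel QCircuitFamily.acceptProbOn QCircuit.acceptProb
  rw [toReal_outputPMF_map_ofFn]
  refine Finset.sum_congr rfl fun z _ => ?_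
  by_cases h : 0 < x.length + F.ancillas x.length
  · rw [dif_pos h]
    have hhead : (List.ofFn z).head? = some (z ⟨0, h⟩) := by
      rw [List.head?_eq_getElem?, List.getElem?_ofFn, dif_pos h]
    simp only [Set.mem_setOf_eq, List.singleton_prefix_iff_head?_eq_some, hhead, Option.some.injEq]
  · rw [dif_neg h]
    have hnil : List.ofFn z = [] := List.ofFn_eq_nil_iff.2 (by omega)
    simp [hnil]

/-- Disjoint output events have total probability at most `1`. [folklore] -/
theorem kernelProb_add_kernelProb_le_one {G : QGateSet} (F : QCircuitFamily G) (A : Language Bool)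
    (x : List Bool) {E₁ E₂ : Set (List Bool)} (h : Disjoint E₁ E₂) :
    F.kernelProb A x E₁ + F.kernelProb A x E₂ ≤ 1 := by
  unfold QCircuitFamily.kernelProb
  set q := F.kernel A x with hq
  have hfin : ∀ E : Set (List Bool), q.toOuterMeasure E ≠ ⊤ := fun E =>
    ne_top_of_le_ne_top ENNReal.one_ne_top ((q.toOuterMeasure.mono (Set.subset_univ E)).trans
      ((PMF.toOuterMeasure_apply_eq_one_iff q Set.univ).2 (Set.subset_univ _)).le)
  rw [← ENNReal.toReal_add (hfin E₁) (hfin E₂)]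
  refine ENNReal.toReal_le_of_le_ofReal zero_le_one ?_
  rw [ENNReal.ofReal_one, PMF.toOuterMeasure_apply, PMF.toOuterMeasure_apply, ← ENNReal.tsum_add,
    ← q.tsum_coe]
  refine ENNReal.tsum_le_tsum fun y => ?_
  have := congrFun (Set.indicator_union_of_disjoint h (⇑q)) y
  rw [← this]
  exact Set.indicator_le_self _ _ y

/-- Strings starting with `true` and strings starting with `false` are disjoint events. [folklore] -/
theorem disjoint_prefix_true_false :
    Disjoint {y : List Bool | [true] <+: y} {y : List Bool | [false] <+: y} := by
  refine Set.disjoint_left.2 fun y h1 h2 => ?_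
  simp only [Set.mem_setOf_eq, List.singleton_prefix_iff_head?_eq_some] at h1 h2
  rw [h1] at h2
  cases h2

/-! ### `BPP^A ⊆ BQP^A` -/

/-- **`BPP^A ⊆ BQP^A` for every oracle language `A`, from the relativized uniform reversible
simulation** (Bernstein–Vazirani 1997, Thm. 8.3 with §8.3): the `bp` witness `L' ∈ P^A` gives the
`FP^A` answer function `w ↦ [w ∈ L']`; the simulating coin family accepts `x` (first output wire
`true`) with probability at least `Pr_y[⟨x, y⟩ ∈ L']` and rejects with probability at least
`Pr_y[⟨x, y⟩ ∉ L']`, whence error `≤ 1/3`.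
[cite: BernsteinVazirani1997SICOMP, Thm. 8.3 (p. 1451) with §8.3 (oracle QTMs)] -/
theorem BPPRel_ofLanguage_subset_BQPRel_of_sim (hsim : uniformOracleCoinSimulation) :
    BPPRel_ofLanguage_subset_BQPRel := by
  classical
  rintro A L ⟨L', hL', p, hp⟩
  have hG : Oracle.ofLanguage L' ∈ FPRel (Oracle.ofLanguage A) :=
    OracleAlg.ofLanguage_mem_FPRel_of_mem_PRel hL'
  obtain ⟨F, hU, hF⟩ := exists_uniform_kernelProb_ge_uniformProb hsim A _ p hG
  have hev : ∀ b : Bool, {y : List Bool | ∃ s ∈ ({[b]} : Set (List Bool)), s <+: y} = {y | [b] <+: y} := by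
    intro b; ext y; simp
  have hcoin : ∀ (x : List Bool) (b : Bool),
      {c : List Bool | Oracle.ofLanguage L' (boolPair x c) ∈ ({[b]} : Set (List Bool))} =
        {c | L'.boolIndicator (boolPair x c) = b} := by
    intro x b; ext c
    simp only [Set.mem_setOf_eq, Oracle.ofLanguage_apply, Set.mem_singleton_iff]
    constructor
    · intro h; exact List.singleton_inj.1 h
    · intro h; rw [h]; rfl
  refine ⟨F, hU, fun x => ⟨fun hx => ?_, fun hx => ?_⟩⟩
  · -- `x ∈ L`: accept with probability `≥ 2/3`
    have h1 := hp x
    have h2 := hF x {[true]}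
    rw [hev, hcoin, kernelProb_prefix_true_eq_acceptProbOn] at h2
    have hset : {y : List Bool | boolPair x y ∈ L' ↔ x ∈ L} = {c | L'.boolIndicator (boolPair x c) = true} := by
      ext y
      simp only [Set.mem_setOf_eq, iff_true_intro hx, iff_true]
      exact Set.mem_iff_boolIndicator _ _
    rw [hset] at h1
    exact h1.trans h2
  · -- `x ∉ L`: accept with probability `≤ 1/3`
    have h1 := hp x
    have h2 := hF x {[false]}
    rw [hev, hcoin] at h2
    have hset : {y : List Bool | boolPair x y ∈ L' ↔ x ∈ L} = {c | L'.boolIndicator (boolPair x c) = false} := by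
      ext y
      simp only [Set.mem_setOf_eq, iff_false_intro hx, iff_false]
      exact Set.notMem_iff_boolIndicator _ _
    rw [hset] at h1
    have h3 := kernelProb_add_kernelProb_le_one F A x disjoint_prefix_true_false
    rw [kernelProb_prefix_true_eq_acceptProbOn] at h3
    linarith

/-- Hence `P^A ⊆ BQP^A` from the simulation fact (with the discharged `P^O ⊆ BPP^O`,
`PRel_subset_BPPRel_holds` is not imported here; stated with the tree fact as hypothesis like
`PRel_ofLanguage_subset_BQPRel_of_BPPRel`). [cite: BernsteinVazirani1997SICOMP, Thm. 8.2 and Thm. 8.3 (p. 1451)] -/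
theorem PRel_ofLanguage_subset_BQPRel_of_sim (hsim : uniformOracleCoinSimulation)
    (hPB : PRel_subset_BPPRel) : PRel_ofLanguage_subset_BQPRel :=
  PRel_ofLanguage_subset_BQPRel_of_BPPRel (BPPRel_ofLanguage_subset_BQPRel_of_sim hsim) hPB

end Literature.Computability.QuantumComplexity

end
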